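import Mathlib
import Literature.MathematicalPhysics.MHD.BallooningSAlphaStableSideTail2
import Literature.Analysis.ValidatedNumerics.TaylorModelZeroCert
import HarnessLib
import Summits.Ventures.FusionMHD.Models.SAlphaStableS125A07375Defs

/-!
# Kernel exclusion certificates, parts A, B, C, for `SAlphaStableS125A07375.lean` (companion file; split for build time only)

The residual straight-line program `resProg` of the `s–α` stable-side instance `(s, α) = (5/4, 59/80)`, its Taylor-model
parameters `prm`, and the KERNEL CHECKS (`decide` + kernel) that every exclusion leaf of parts
A `[0, 2]`, B `[2, 4]`, C `[4, 8]` excludes a zero of the program.  Pure `Bool`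
computations over `Literature/Analysis/ValidatedNumerics/TaylorModelZeroCert.lean`; their real-analysis reading
(`res_ne_zero*`, via `OpTangent.trig.forall_ne_zero_of_zerosCheck` and `resProg_toFunP`) is in `SAlphaStableS125A07375.lean`.
Tilings = PROPOSALS of the untrusted `#eval OpModel.trig.exclAdapt`, re-checked here by the kernel.
3 `decide +kernel`, no `native_decide`, 0 kit, 0 named facts. [instance data]
[cite: Freidberg2014, §12.6.2 eqs. (12.96)–(12.100)]
-/

noncomputable section

open Real Set
open Literature.Analysis.ValidatedNumerics.PolyMP
open Literature.Analysis.ValidatedNumerics.ExpPoly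
open Literature.MathematicalPhysics.MHD.Ballooning

namespace Summit.Ventures.FusionMHD.Models

namespace SAlphaStableS125A07375

/-- THE RESIDUAL PROGRAM (25 statements): `Λ = sθ − α sin θ`, `f = 1 + Λ²`, `ŝ = s − α cos θ`;
computes `f²·F″ + (α cos θ · f − ŝ²)·F`. [instance data] -/
def resProg : TProg := [
  TOp.base (SOp.poly [0, (5 : ℚ) / 4]),
  TOp.base (SOp.poly [0, 1]),
  TOp.sin 0,
  TOp.cos 1,
  TOp.base (SOp.poly [(-59 : ℚ) / 80]),
  TOp.base (SOp.mul 0 2),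
  TOp.base (SOp.add 5 0),
  TOp.base (SOp.mul 0 0),
  TOp.base (SOp.poly [1]),
  TOp.base (SOp.add 0 1),
  TOp.base (SOp.mul 0 0),
  TOp.base (SOp.mul 6 7),
  TOp.base (SOp.poly [(5 : ℚ) / 4]),
  TOp.base (SOp.add 0 1),
  TOp.base (SOp.mul 0 0),
  TOp.base (SOp.poly [(59 : ℚ) / 80]),
  TOp.base (SOp.mul 0 12),
  TOp.base (SOp.mul 0 7),
  TOp.base (SOp.neg 3),
  TOp.base (SOp.add 1 0),
  TOp.base (SOp.poly coreCoeffs),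
  TOp.base (SOp.poly coreCoeffs2),
  TOp.base (SOp.mul 11 0),
  TOp.base (SOp.mul 3 2),
  TOp.base (SOp.add 1 0) ]

/-- Taylor-model parameters (degree 12; 14 series terms; `e^{ic}` point values: 20 terms after 5 halvings — `PolyMP.cisPt`
needs `|leaf centre| ≤ 2^kt`, so `kt = 5` serves centres up to `32`); fixed-point scale `2^60`. [instance data] -/
def prm : TrigPrm := ⟨12, 14, 1, 1, 40, 20, 5⟩

/-- The 10 EXCLUSION LEAVES of certificate part A, tiling `[0, 2]` (half-widths 1 / 64, 1 / 32, 1 / 16, 1 / 8, 1 / 4; proposed by the untrusted `#eval OpModel.trig.exclAdapt`). [instance data] -/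
def leavesA : List ZLeaf :=
  [⟨1 / 64, 1 / 64, [], [], [], none⟩, ⟨3 / 64, 1 / 64, [], [], [], none⟩, ⟨3 / 32, 1 / 32, [], [], [], none⟩, ⟨3 / 16, 1 / 16, [], [], [], none⟩, ⟨3 / 8, 1 / 8, [], [], [], none⟩, ⟨5 / 8, 1 / 8, [], [], [], none⟩, ⟨7 / 8, 1 / 8, [], [], [], none⟩, ⟨5 / 4, 1 / 4, [], [], [], none⟩, ⟨13 / 8, 1 / 8, [], [], [], none⟩, ⟨15 / 8, 1 / 8, [], [], [], none⟩]

/-- The 5 EXCLUSION LEAVES of certificate part B, tiling `[2, 4]` (half-widths 1 / 8, 1 / 4; proposed by the untrusted `#eval OpModel.trig.exclAdapt`). [instance data] -/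
def leavesB : List ZLeaf :=
  [⟨17 / 8, 1 / 8, [], [], [], none⟩, ⟨19 / 8, 1 / 8, [], [], [], none⟩, ⟨11 / 4, 1 / 4, [], [], [], none⟩, ⟨13 / 4, 1 / 4, [], [], [], none⟩, ⟨15 / 4, 1 / 4, [], [], [], none⟩]

/-- The 4 EXCLUSION LEAVES of certificate part C, tiling `[4, 8]` (half-widths 1 / 2; proposed by the untrusted `#eval OpModel.trig.exclAdapt`). [instance data] -/
def leavesC : List ZLeaf :=
  [⟨9 / 2, 1 / 2, [], [], [], none⟩, ⟨11 / 2, 1 / 2, [], [], [], none⟩, ⟨13 / 2, 1 / 2, [], [], [], none⟩, ⟨15 / 2, 1 / 2, [], [], [], none⟩]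

/-- **KERNEL CHECK, part A**: every leaf's Taylor model of `resProg` on `[0, 2]` excludes `0` (no Newton leaf).
[instance data] -/
theorem zeros_certA :
    OpTangent.trig.toOpTangentCore.zerosCheck prm (2 ^ 60) resProg [] (0) (2) leavesA = true := by
  decide +kernel

/-- **KERNEL CHECK, part B**: every leaf's Taylor model of `resProg` on `[2, 4]` excludes `0` (no Newton leaf).
[instance data] -/
theorem zeros_certB :
    OpTangent.trig.toOpTangentCore.zerosCheck prm (2 ^ 60) resProg [] (2) (4) leavesB = true := by
  decide +kernel

/-- **KERNEL CHECK, part C**: every leaf's Taylor model of `resProg` on `[4, 8]` excludes `0` (no Newton leaf).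
[instance data] -/
theorem zeros_certC :
    OpTangent.trig.toOpTangentCore.zerosCheck prm (2 ^ 60) resProg [] (4) (8) leavesC = true := by
  decide +kernel

end SAlphaStableS125A07375

end Summit.Ventures.FusionMHD.Models

end
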